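import Summits.ValiantsHypothesis.ValiantsHypothesis.Theorems.BarrierLeverPartitionMinorsHitByVPDownCompression
import Summits.ValiantsHypothesis.ValiantsHypothesis.Theorems.BarrierLeverPartitionMinorsHitByVPDownCompressionPass
import Summits.ValiantsHypothesis.ValiantsHypothesis.Theorems.BarrierLeverPartitionMinorsHitByVPAdditiveDoor

/-!
# Route BarrierLever — item `PartitionMinorsHitByVP` (stmt-ValiantsHypothesis-19717):
# the witness-agnostic LOWER-SET REDUCTION — simplicial-complex layouts suffice (route-independent core)

Helper file (`--supports stmt-ValiantsHypothesis-19717`; cell valiant-natproofs, rung V4, 𝒟-side door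
(c); prover seat val-np-p1 gen 12). Definition-free, does NOT import the route file. Closes NO item: it
reduces the hitting problem of item 19717 to its own restriction to layouts `(u, w)` whose row family
AND column family are LOWER SETS (simplicial complexes: closed under taking subsets), for EVERY witness
class at once; the by-name links to `Theses.BarrierLever.PartitionMinorsHitByVP` and to the doors of
record are in the companion `…PartitionMinorsHitByVPOfLowerSetsDoors`.

**Mechanism** (part 1, `…DownCompression`: the zeon observation). For any polynomial `f`, the
multilinear coefficients of `f · (1 + t x_a)` are `row_U + t · [a ∈ U] · row_{U∖a}`, so the top
`t`-coefficient of the partition minor of `(u, w)` at `f · (1 + t x_a)` is the partition minor of the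
down-compressed layout `(𝓓_a u, w)` at `f` (`DownCompression.step_x`; columns: `step_y`). One pass
`𝓓_0, …, 𝓓_{h-1}` on each side reaches a lower set (`…DownCompressionPass`), so a witness for the
compressed pair times `∏_a (1 + t_a x_a) · ∏_c (1 + s_c y_c)` (suitable scalars) is a witness for
`(u, w)`: size `+ 6h`, degree `+ 2h` (`exists_witness_of_lowerSets`); the truncation
`Σ_{e ≤ 2h} F^{(e)}` (`AdditiveDoor.truncation_spec`, BCS Lemma 21.25 in tree) restores degree `≤ 2h`
inside `SmallCircuits ℂ (h+h) (b+4)` for `h ≥ 4` (`exists_smallCircuit_of_lowerSets`).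

**Results.**
* `iterate_x`, `iterate_y` — all row (column) compressions, one coordinate at a time;
* `exists_witness_of_lowerSets` — **THE REDUCTION, explicit form**: if every injective layout with
  both ranges lower sets is hit at size `≤ s` and degree `≤ d`, every injective layout is hit at size
  `≤ s + 6h` and degree `≤ d + 2h`;
* `exists_smallCircuit_of_lowerSets` — class form: lower-set pairs hit inside `SmallCircuits ℂ (h+h) b`
  for `h ≥ h₀` ⇒ all injective layouts hit inside `SmallCircuits ℂ (h+h) (b+4)` for `h ≥ max h₀ 4`
  (`size_le_pow` is the arithmetic).

WHAT THIS IS NOT: no proof of the lower-set case or of item 19717; nothing on crux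
stmt-ValiantsHypothesis-14610 or on `VP` versus `VNP`.
-/

set_option linter.dupNamespace false

namespace Summit.ValiantsHypothesis.ValiantsHypothesis.Theorems.BarrierLever.DownCompression

open Finset MvPolynomial
open Literature.Barriers.ValiantsHypothesis Literature.Computability.AlgebraicComplexity
open Summit.ValiantsHypothesis.ValiantsHypothesis.Theorems.BarrierLever.AdditiveDoor
  (truncation_spec degree_partitionExpo_le complexity_one_add_C_mul_X_le)

noncomputable section

variable {h r : ℕ}

/-! ## 1. Auxiliary bounds for one linear factor -/

/-- `deg (1 + t · X v) ≤ 1`. -/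
theorem totalDegree_one_add_C_mul_X_le {σ : Type*} (t : ℂ) (v : σ) :
    (1 + C t * X v : MvPolynomial σ ℂ).totalDegree ≤ 1 := by
  refine (totalDegree_add _ _).trans (max_le ?_ ?_)
  · rw [totalDegree_one]; exact zero_le_one
  · refine (totalDegree_mul _ _).trans ?_
    rw [totalDegree_C, totalDegree_X, zero_add]

/-- Multiplying by `1 + t · X v` costs `≤ 3` gates and `≤ 1` degree. -/
theorem bounds_mul_one_add_C_mul_X {σ : Type*} (f : MvPolynomial σ ℂ) (t : ℂ) (v : σ) (s d : ℕ)
    (hs : complexity f ≤ s) (hd : f.totalDegree ≤ d) :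
    complexity (f * (1 + C t * X v)) ≤ s + 3 ∧ (f * (1 + C t * X v)).totalDegree ≤ d + 1 := by
  constructor
  · calc complexity (f * (1 + C t * X v))
        ≤ complexity f + complexity (1 + C t * X v : MvPolynomial σ ℂ) + 1 := complexity_mul_le_holds _ _
      _ ≤ s + 2 + 1 := by gcongr; exact complexity_one_add_C_mul_X_le t v
  · exact (totalDegree_mul _ _).trans (add_le_add hd (totalDegree_one_add_C_mul_X_le t v))

/-! ## 2. Iterating the steps: all `x`-coordinates, then all `y`-coordinates -/

/-- **All row compressions.** Fix the columns `w`. If every injective row family with lower-set range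
is hit (against `w`) at size `≤ s` and degree `≤ d`, then every injective row family `u` that is already
`a`-compressed for the coordinates `a` with `a + m < h` is hit at size `≤ s + 3m`, degree `≤ d + m`. -/
theorem iterate_x (w : Fin r → Finset (Fin h)) (s d : ℕ)
    (hyp : ∀ v : Fin r → Finset (Fin h), Function.Injective v → IsLowerSet (Set.range v) →
      ∃ f : MvPolynomial (Fin (h + h)) ℂ, complexity f ≤ s ∧ f.totalDegree ≤ d ∧
        (Matrix.of fun i j : Fin r => MvPolynomial.coeff
          (∑ a ∈ v i, Finsupp.single (Fin.castAdd h a) 1 +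
            ∑ c ∈ w j, Finsupp.single (Fin.natAdd h c) 1) f).det ≠ 0) :
    ∀ m : ℕ, m ≤ h → ∀ u : Fin r → Finset (Fin h), Function.Injective u →
      (∀ a : Fin h, a.val + m < h → ∀ i, a ∈ u i → ∃ k, u k = (u i).erase a) →
      ∃ f : MvPolynomial (Fin (h + h)) ℂ, complexity f ≤ s + 3 * m ∧ f.totalDegree ≤ d + m ∧
        (Matrix.of fun i j : Fin r => MvPolynomial.coeff
          (∑ a ∈ u i, Finsupp.single (Fin.castAdd h a) 1 +
            ∑ c ∈ w j, Finsupp.single (Fin.natAdd h c) 1) f).det ≠ 0 := by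
  classical
  intro m
  induction m with
  | zero =>
    intro _ u hu hcomp
    have hlow : IsLowerSet (Set.range u) :=
      isLowerSet_range_of_isComp u (fun a i hai => hcomp a (by have := a.isLt; omega) i hai)
    obtain ⟨f, hfs, hfd, hf⟩ := hyp u hu hlow
    exact ⟨f, by omega, by omega, hf⟩
  | succ m ih =>
    intro hm u hu hcomp
    -- compress the coordinate `a₀ = h - (m + 1)`
    set a₀ : Fin h := ⟨h - (m + 1), by omega⟩ with ha₀_def
    let v : Fin r → Finset (Fin h) := fun i =>
      if a₀ ∈ u i ∧ ∀ k, u k ≠ (u i).erase a₀ then (u i).erase a₀ else u i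
    have hv₁ : ∀ i, a₀ ∈ u i → (∀ k, u k ≠ (u i).erase a₀) → v i = (u i).erase a₀ :=
      fun i h1 h2 => by simp only [v, if_pos (And.intro h1 h2)]
    have hv₂ : ∀ i, ¬ (a₀ ∈ u i ∧ ∀ k, u k ≠ (u i).erase a₀) → v i = u i :=
      fun i h1 => by simp only [v, if_neg h1]
    have hv_inj : Function.Injective v := injective_of_compOf u v a₀ hu hv₁ hv₂
    have hv_comp : ∀ a : Fin h, a.val + m < h → ∀ i, a ∈ v i → ∃ k, v k = (v i).erase a := by
      intro a ha
      by_cases haa : a = a₀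
      · subst haa
        exact isComp_of_compOf u v _ hv₁ hv₂
      · have ha' : a.val + (m + 1) < h := by
          have : a.val ≠ h - (m + 1) := fun hv => haa (Fin.ext (by rw [hv, ha₀_def]))
          omega
        exact isComp_of_compOf_of_isComp u v a a₀ (hcomp a ha') hv₁ hv₂
    obtain ⟨f, hfs, hfd, hf⟩ := ih (by omega) v hv_inj hv_comp
    obtain ⟨t, ht⟩ := step_x u v w a₀ hv₁ hv₂ f hf
    obtain ⟨hs', hd'⟩ := bounds_mul_one_add_C_mul_X f t (Fin.castAdd h a₀) _ _ hfs hfd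
    exact ⟨f * (1 + C t * X (Fin.castAdd h a₀)), by omega, by omega, ht⟩

/-- **All column compressions.** Fix the rows `u`. If every injective column family with lower-set
range is hit (against `u`) at size `≤ s` and degree `≤ d`, then every injective column family `w`
already `c`-compressed for the coordinates `c` with `c + m < h` is hit at size `≤ s + 3m`, degree
`≤ d + m`. -/
theorem iterate_y (u : Fin r → Finset (Fin h)) (s d : ℕ)
    (hyp : ∀ w' : Fin r → Finset (Fin h), Function.Injective w' → IsLowerSet (Set.range w') →
      ∃ f : MvPolynomial (Fin (h + h)) ℂ, complexity f ≤ s ∧ f.totalDegree ≤ d ∧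
        (Matrix.of fun i j : Fin r => MvPolynomial.coeff
          (∑ a ∈ u i, Finsupp.single (Fin.castAdd h a) 1 +
            ∑ c ∈ w' j, Finsupp.single (Fin.natAdd h c) 1) f).det ≠ 0) :
    ∀ m : ℕ, m ≤ h → ∀ w : Fin r → Finset (Fin h), Function.Injective w →
      (∀ c : Fin h, c.val + m < h → ∀ j, c ∈ w j → ∃ k, w k = (w j).erase c) →
      ∃ f : MvPolynomial (Fin (h + h)) ℂ, complexity f ≤ s + 3 * m ∧ f.totalDegree ≤ d + m ∧
        (Matrix.of fun i j : Fin r => MvPolynomial.coeff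
          (∑ a ∈ u i, Finsupp.single (Fin.castAdd h a) 1 +
            ∑ c ∈ w j, Finsupp.single (Fin.natAdd h c) 1) f).det ≠ 0 := by
  classical
  intro m
  induction m with
  | zero =>
    intro _ w hw hcomp
    have hlow : IsLowerSet (Set.range w) :=
      isLowerSet_range_of_isComp w (fun c j hcj => hcomp c (by have := c.isLt; omega) j hcj)
    obtain ⟨f, hfs, hfd, hf⟩ := hyp w hw hlow
    exact ⟨f, by omega, by omega, hf⟩
  | succ m ih =>
    intro hm w hw hcomp
    set c₀ : Fin h := ⟨h - (m + 1), by omega⟩ with hc₀_def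
    let w' : Fin r → Finset (Fin h) := fun j =>
      if c₀ ∈ w j ∧ ∀ k, w k ≠ (w j).erase c₀ then (w j).erase c₀ else w j
    have hw₁ : ∀ j, c₀ ∈ w j → (∀ k, w k ≠ (w j).erase c₀) → w' j = (w j).erase c₀ :=
      fun j h1 h2 => by simp only [w', if_pos (And.intro h1 h2)]
    have hw₂ : ∀ j, ¬ (c₀ ∈ w j ∧ ∀ k, w k ≠ (w j).erase c₀) → w' j = w j :=
      fun j h1 => by simp only [w', if_neg h1]
    have hw_inj : Function.Injective w' := injective_of_compOf w w' c₀ hw hw₁ hw₂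
    have hw_comp : ∀ c : Fin h, c.val + m < h → ∀ j, c ∈ w' j → ∃ k, w' k = (w' j).erase c := by
      intro c hc
      by_cases hcc : c = c₀
      · subst hcc
        exact isComp_of_compOf w w' _ hw₁ hw₂
      · have hc' : c.val + (m + 1) < h := by
          have : c.val ≠ h - (m + 1) := fun hv => hcc (Fin.ext (by rw [hv, hc₀_def]))
          omega
        exact isComp_of_compOf_of_isComp w w' c c₀ (hcomp c hc') hw₁ hw₂
    obtain ⟨f, hfs, hfd, hf⟩ := ih (by omega) w' hw_inj hw_comp
    obtain ⟨t, ht⟩ := step_y u w w' c₀ hw₁ hw₂ f hf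
    obtain ⟨hs', hd'⟩ := bounds_mul_one_add_C_mul_X f t (Fin.natAdd h c₀) _ _ hfs hfd
    exact ⟨f * (1 + C t * X (Fin.natAdd h c₀)), by omega, by omega, ht⟩

/-! ## 3. The reduction with explicit size and degree -/

/-- **Lower-set pairs suffice (explicit form).** If every injective layout with BOTH ranges lower
sets is hit at size `≤ s` and degree `≤ d`, then every injective layout is hit at size `≤ s + 6h`
and degree `≤ d + 2h` (by a witness of the form `f · ∏_a (1 + t_a x_a) · ∏_c (1 + s_c y_c)`). -/
theorem exists_witness_of_lowerSets (s d : ℕ)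
    (hyp : ∀ v w' : Fin r → Finset (Fin h), Function.Injective v → Function.Injective w' →
      IsLowerSet (Set.range v) → IsLowerSet (Set.range w') →
      ∃ f : MvPolynomial (Fin (h + h)) ℂ, complexity f ≤ s ∧ f.totalDegree ≤ d ∧
        (Matrix.of fun i j : Fin r => MvPolynomial.coeff
          (∑ a ∈ v i, Finsupp.single (Fin.castAdd h a) 1 +
            ∑ c ∈ w' j, Finsupp.single (Fin.natAdd h c) 1) f).det ≠ 0)
    (u w : Fin r → Finset (Fin h)) (hu : Function.Injective u) (hw : Function.Injective w) :
    ∃ f : MvPolynomial (Fin (h + h)) ℂ, complexity f ≤ s + 6 * h ∧ f.totalDegree ≤ d + (h + h) ∧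
      (Matrix.of fun i j : Fin r => MvPolynomial.coeff
        (∑ a ∈ u i, Finsupp.single (Fin.castAdd h a) 1 +
          ∑ c ∈ w j, Finsupp.single (Fin.natAdd h c) 1) f).det ≠ 0 := by
  -- lower-set rows against the ACTUAL columns `w`: all column compressions
  have hyX : ∀ v : Fin r → Finset (Fin h), Function.Injective v → IsLowerSet (Set.range v) →
      ∃ f : MvPolynomial (Fin (h + h)) ℂ, complexity f ≤ s + 3 * h ∧ f.totalDegree ≤ d + h ∧
        (Matrix.of fun i j : Fin r => MvPolynomial.coeff
          (∑ a ∈ v i, Finsupp.single (Fin.castAdd h a) 1 +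
            ∑ c ∈ w j, Finsupp.single (Fin.natAdd h c) 1) f).det ≠ 0 :=
    fun v hv hlv => iterate_y v s d (fun w' hw' hlw' => hyp v w' hv hw' hlv hlw') h le_rfl w hw
      (fun c hc => absurd hc (by omega))
  -- then all row compressions
  obtain ⟨f, hfs, hfd, hf⟩ := iterate_x w (s + 3 * h) (d + h) hyX h le_rfl u hu
    (fun a ha => absurd ha (by omega))
  exact ⟨f, by omega, by omega, hf⟩

/-- Size bookkeeping: `(2h+2)² ((2h)^b + 6h) + 2h + 1 ≤ (2h)^(b+4)` for `h ≥ 4`. -/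
theorem size_le_pow (h b : ℕ) (hh : 4 ≤ h) :
    (h + h + 2) ^ 2 * ((h + h) ^ b + 6 * h) + (h + h + 1) ≤ (h + h) ^ (b + 4) := by
  have hP : 1 ≤ (h + h) ^ b := Nat.one_le_pow _ _ (by omega)
  set P := (h + h) ^ b with hP_def
  have hpoly : (h + h + 2) ^ 2 * (1 + 6 * h) + (h + h + 1) ≤ (h + h) ^ 4 := by
    have h3 : 64 * h ^ 3 ≤ 16 * h ^ 4 := by
      have e : 4 * h ^ 3 ≤ h * h ^ 3 := Nat.mul_le_mul_right _ hh
      calc 64 * h ^ 3 = 16 * (4 * h ^ 3) := by ring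
        _ ≤ 16 * (h * h ^ 3) := Nat.mul_le_mul_left _ e
        _ = 16 * h ^ 4 := by ring
    have h2 : 160 * h ^ 2 ≤ 40 * h ^ 3 := by
      have e : 4 * h ^ 2 ≤ h * h ^ 2 := Nat.mul_le_mul_right _ hh
      calc 160 * h ^ 2 = 40 * (4 * h ^ 2) := by ring
        _ ≤ 40 * (h * h ^ 2) := Nat.mul_le_mul_left _ e
        _ = 40 * h ^ 3 := by ring
    have h1 : 432 * h ≤ 108 * h ^ 2 := by
      have e : 4 * h ≤ h * h := Nat.mul_le_mul_right _ hh
      calc 432 * h = 108 * (4 * h) := by ring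
        _ ≤ 108 * (h * h) := Nat.mul_le_mul_left _ e
        _ = 108 * h ^ 2 := by ring
    have h0 : 5 ≤ 398 * h := by omega
    have lhs : (h + h + 2) ^ 2 * (1 + 6 * h) + (h + h + 1) =
        24 * h ^ 3 + 52 * h ^ 2 + 34 * h + 5 := by ring
    have rhs : (h + h) ^ 4 = 16 * h ^ 4 := by ring
    rw [lhs, rhs]
    linarith
  have e1 : 6 * h ≤ 6 * h * P := Nat.le_mul_of_pos_right _ hP
  have e2 : h + h + 1 ≤ (h + h + 1) * P := Nat.le_mul_of_pos_right _ hP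
  calc (h + h + 2) ^ 2 * (P + 6 * h) + (h + h + 1)
      ≤ (h + h + 2) ^ 2 * (P + 6 * h * P) + (h + h + 1) * P :=
        Nat.add_le_add (Nat.mul_le_mul_left _ (Nat.add_le_add_left e1 _)) e2
    _ = P * ((h + h + 2) ^ 2 * (1 + 6 * h) + (h + h + 1)) := by ring
    _ ≤ P * (h + h) ^ 4 := Nat.mul_le_mul_left _ hpoly
    _ = (h + h) ^ (b + 4) := by rw [hP_def, ← pow_add]

/-- **Lower-set pairs suffice (class form).** If for `h ≥ h₀` every injective layout with both
ranges lower sets is hit inside `SmallCircuits ℂ (h+h) b`, then for `h ≥ max h₀ 4` every injective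
layout is hit inside `SmallCircuits ℂ (h+h) (b+4)`. -/
theorem exists_smallCircuit_of_lowerSets (b h₀ : ℕ)
    (hyp : ∀ h : ℕ, h₀ ≤ h → ∀ (r : ℕ) (v w' : Fin r → Finset (Fin h)),
      Function.Injective v → Function.Injective w' →
      IsLowerSet (Set.range v) → IsLowerSet (Set.range w') →
      ∃ f ∈ SmallCircuits ℂ (h + h) b,
        (Matrix.of fun i j : Fin r => MvPolynomial.coeff
          (∑ a ∈ v i, Finsupp.single (Fin.castAdd h a) 1 +
            ∑ c ∈ w' j, Finsupp.single (Fin.natAdd h c) 1) f).det ≠ 0)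
    (h : ℕ) (hh : max h₀ 4 ≤ h) (r : ℕ) (u w : Fin r → Finset (Fin h))
    (hu : Function.Injective u) (hw : Function.Injective w) :
    ∃ f ∈ SmallCircuits ℂ (h + h) (b + 4),
      (Matrix.of fun i j : Fin r => MvPolynomial.coeff
        (∑ a ∈ u i, Finsupp.single (Fin.castAdd h a) 1 +
          ∑ c ∈ w j, Finsupp.single (Fin.natAdd h c) 1) f).det ≠ 0 := by
  have hh₀ : h₀ ≤ h := le_trans (le_max_left _ _) hh
  have h4 : 4 ≤ h := le_trans (le_max_right _ _) hh
  obtain ⟨g, hgs, hgd, hg⟩ := exists_witness_of_lowerSets ((h + h) ^ b) (h + h)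
    (fun v w' hv hw' hlv hlw' => by
      obtain ⟨f, ⟨hfd, hfs⟩, hf⟩ := hyp h hh₀ r v w' hv hw' hlv hlw'
      exact ⟨f, hfs, hfd, hf⟩) u w hu hw
  obtain ⟨hdeg, hcoeff, hsize⟩ := truncation_spec g (h + h)
  refine ⟨∑ e ∈ Finset.range (h + h + 1), homogeneousComponent e g, ⟨hdeg, ?_⟩, ?_⟩
  · calc complexity (∑ e ∈ Finset.range (h + h + 1), homogeneousComponent e g)
        ≤ (h + h + 2) ^ 2 * complexity g + (h + h + 1) := hsize
      _ ≤ (h + h + 2) ^ 2 * ((h + h) ^ b + 6 * h) + (h + h + 1) := by gcongr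
      _ ≤ (h + h) ^ (b + 4) := size_le_pow h b h4
  · have hmat : (Matrix.of fun i j : Fin r => MvPolynomial.coeff
        (∑ a ∈ u i, Finsupp.single (Fin.castAdd h a) 1 +
          ∑ c ∈ w j, Finsupp.single (Fin.natAdd h c) 1)
        (∑ e ∈ Finset.range (h + h + 1), homogeneousComponent e g)) =
        Matrix.of fun i j : Fin r => MvPolynomial.coeff
          (∑ a ∈ u i, Finsupp.single (Fin.castAdd h a) 1 +
            ∑ c ∈ w j, Finsupp.single (Fin.natAdd h c) 1) g := by
      ext i j
      rw [Matrix.of_apply, Matrix.of_apply, hcoeff _ (degree_partitionExpo_le _ _)]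
    rw [hmat]
    exact hg

end

end Summit.ValiantsHypothesis.ValiantsHypothesis.Theorems.BarrierLever.DownCompression
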